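import Summits.ValiantsHypothesis.ValiantsHypothesis.Theorems.BarrierLeverChowBenchmarkPairsBlockPeelStage
import Summits.ValiantsHypothesis.ValiantsHypothesis.Theorems.BarrierLeverChowBenchmarkPairsBlockPeelLead
import Summits.ValiantsHypothesis.ValiantsHypothesis.Theorems.BarrierLeverChowBenchmarkPairsKernelPoised
import Summits.ValiantsHypothesis.ValiantsHypothesis.Theorems.BarrierLeverChowBenchmarkPairsKernelPeel

/-!
# Route BarrierLever — item 22038 `ChowBenchmarkPairs`, line `moore-peel`: the BLOCK PEEL, IV — THE BLOCK PEEL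
# THEOREM: a tiling of the stages `[1, h]` by blocks with nonzero symbolic block determinants gives
# `KernelPoisedAt κ h`; for `κ = k!`, `SegmentMeanValueAt h` (the statement of node #1 `stub_segmentMeanValue`)

Helper file (`--supports stmt-ValiantsHypothesis-22038`; cell valiant-natproofs, rung V4, 𝒟-side benchmark of
record, line `moore_peel`, planner kernel target **K1** (HOME/STATUS.md l.1746: «the block peel theorem as an
h-free Lean statement — disjoint nonsingular tied blocks covering the bad stages ⇒ SegmentMeanValueAt h»); seat
val-np-p4 gen 29).  Closes NO item; definition-free.  Memo `HOME/val-np-p4/g28/memo/MEMO-valnp4-g28.md` §1.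

* `kblock_step` — ONE BLOCK: independence at stage `(i+t, n)` and `det J^κ(i,t)(Λ) ≠ 0` in `ℤ[Λ_0,…,Λ_{t-1}]`
  (`blockMatrix` of `…BlockPeelRows` at the generic ratios `Λ_s = X_s`) give independence at stage `(i, n+t)`
  (the tied substitution `X_{n+s} ↦ C(X_{n+s})·X` is an INJECTIVE algebra map — evaluation at `X = 1` retracts
  it — then `…BlockPeelStage` and `…BlockPeelLead`).
* **`linearIndependent_krow_stageOne_of_blocks` (THE BLOCK PEEL THEOREM)** — cut points
  `1 = a 0 < a 1 < ⋯ < a m = h + 1` with `det J^κ(a q, a (q+1) - a q) ≠ 0` for every `q < m` ⇒ the stage-1 rows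
  are linearly independent over `MvPolynomial (Fin h) ℂ`; hence **`kernelPoisedAt_of_blocks`** and, for
  `κ = Nat.factorial`, **`segmentMeanValueAt_of_blocks`** = the line file's `SegmentMeanValueAt h` VERBATIM.
  Blocks of length `1` are the stages of THEOREM A^κ (`det J^κ(i,1) ≠ 0 ↔ det G^κ_i ≠ 0`,
  `det_blockMatrix_one_ne_zero_iff`), so THEOREM A^κ is the all-singleton tiling and the certificates of record
  (124 disjoint tied blocks over the 143 bad stages of THEOREM W below `20 070`, all other stages singles;
  kit j323569/j323570/j324541/j324542) are literally hypotheses of this theorem — numerically verified, NOT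
  kernel-checked (the smallest nontrivial block `{182,183}` is a `365 × 365` determinant).

WHAT THIS IS NOT: the stub `stub_segmentMeanValue` (∀ h) is NOT closed — the theorem is conditional on a block
certificate per height; nothing on crux stmt-ValiantsHypothesis-14610 or on `VP` versus `VNP`.
-/

set_option linter.dupNamespace false

namespace Summit.ValiantsHypothesis.ValiantsHypothesis.Theorems.BarrierLever.MoorePeel

open Polynomial Finset

/-! ## 7. Transport of the symbolic block determinant -/

/-- The symbolic block determinant `det J^κ(i,t)(Λ) ∈ ℤ[Λ]` specialises injectively to the ratios
`Λ_s = X_{n+s}` of `MvPolynomial (Fin h) ℂ` (`n + t ≤ h`). -/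
theorem det_blockMatrix_nodeY_ne_zero (κ : ℕ → ℕ) (h i n t : ℕ) (hnt : n + t ≤ h)
    (hJ : (blockMatrix κ i t (fun s : Fin t => (MvPolynomial.X s : MvPolynomial (Fin t) ℤ))).det ≠ 0) :
    (blockMatrix κ i t (fun s : Fin t => nodeY h (n + (s : ℕ)))).det ≠ 0 := by
  set g : Fin t → Fin h := fun s => ⟨n + (s : ℕ), by have := s.2; omega⟩ with hg
  have hginj : Function.Injective g := fun s s' e => by
    have := congrArg Fin.val e
    simp only [hg] at this
    exact Fin.ext (by omega)
  set f : MvPolynomial (Fin t) ℤ →+* MvPolynomial (Fin h) ℂ :=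
    (MvPolynomial.rename g).toRingHom.comp (MvPolynomial.map (Int.castRingHom ℂ)) with hf
  have hfinj : Function.Injective f :=
    (MvPolynomial.rename_injective g hginj).comp (MvPolynomial.map_injective _ Int.cast_injective)
  have hfX : ∀ s : Fin t, f (MvPolynomial.X s) = nodeY h (n + (s : ℕ)) := by
    intro s
    rw [hf, RingHom.comp_apply, MvPolynomial.map_X, AlgHom.toRingHom_eq_coe, RingHom.coe_coe,
      MvPolynomial.rename_X, nodeY, dif_pos (by have := s.2; omega)]
  intro h0
  apply hJ
  apply hfinj
  rw [map_zero, map_det_blockMatrix]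
  simp_rw [hfX]
  exact h0

/-! ## 8. One block -/

/-- **THE BLOCK STEP.**  Let `i + t + n = h + 1`, `1 ≤ i`, `κ` without zeros.  If the rows alive at stage
`(i+t, n)` are linearly independent over `MvPolynomial (Fin h) ℂ` and the symbolic block determinant
`det J^κ(i,t)(Λ) ∈ ℤ[Λ]` is nonzero, then the rows alive at stage `(i, n+t)` are linearly independent. -/
theorem kblock_step (κ : ℕ → ℕ) (hκ : ∀ k, κ k ≠ 0) (h i t n : ℕ) (hitn : i + t + n = h + 1) (hi : 1 ≤ i)
    (hJ : (blockMatrix κ i t (fun s : Fin t => (MvPolynomial.X s : MvPolynomial (Fin t) ℤ))).det ≠ 0)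
    (IH : LinearIndependent (MvPolynomial (Fin h) ℂ)
      (fun y : ↥(stageRows (i + t) n) => krow κ (windowStart (h + 1)) (nodeY h) (y : RowLabel))) :
    LinearIndependent (MvPolynomial (Fin h) ℂ)
      (fun x : ↥(stageRows i (n + t)) => krow κ (windowStart (h + 1)) (nodeY h) (x : RowLabel)) := by
  classical
  have hnt : n + t ≤ h := by omega
  -- the tied substitution `X_v ↦ C(X_v)·X` on the block, an injective algebra map `A → A[X]`
  set σ : MvPolynomial (Fin h) ℂ →ₐ[ℂ] Polynomial (MvPolynomial (Fin h) ℂ) :=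
    MvPolynomial.aeval fun v : Fin h =>
      if n ≤ (v : ℕ) ∧ (v : ℕ) < n + t then Polynomial.C (MvPolynomial.X v) * Polynomial.X
      else Polynomial.C (MvPolynomial.X v) with hσ
  have hσX : ∀ v : Fin h, σ (MvPolynomial.X v) =
      if n ≤ (v : ℕ) ∧ (v : ℕ) < n + t then Polynomial.C (MvPolynomial.X v) * Polynomial.X
      else Polynomial.C (MvPolynomial.X v) := fun v => by
    rw [hσ, MvPolynomial.aeval_X]
  have hσinj : Function.Injective σ := by
    set τ : Polynomial (MvPolynomial (Fin h) ℂ) →ₐ[MvPolynomial (Fin h) ℂ] MvPolynomial (Fin h) ℂ :=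
      Polynomial.aeval (1 : MvPolynomial (Fin h) ℂ) with hτ
    have hcomp : (τ.restrictScalars ℂ).comp σ = AlgHom.id ℂ _ := by
      refine MvPolynomial.algHom_ext fun v => ?_
      rw [AlgHom.comp_apply, AlgHom.restrictScalars_apply, hσX, AlgHom.id_apply]
      split_ifs
      · rw [map_mul, hτ, Polynomial.aeval_C, Polynomial.aeval_X, mul_one]
        rfl
      · rw [hτ, Polynomial.aeval_C]
        rfl
    intro p q e
    have := congrArg (τ.restrictScalars ℂ) e
    rwa [← AlgHom.comp_apply, ← AlgHom.comp_apply, hcomp, AlgHom.id_apply, AlgHom.id_apply] at this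
  -- the node table after substitution
  set Z : ℕ → Polynomial (MvPolynomial (Fin h) ℂ) := fun b => σ (nodeY h b) with hZ
  have hZt : ∀ b, n ≤ b → b < n + t → Z b = Polynomial.C (nodeY h b) * Polynomial.X := by
    intro b hb1 hb2
    have hb : b < h := by omega
    simp only [hZ, nodeY, dif_pos hb, hσX, hb1, hb2, and_self, if_true]
  have hZlt : ∀ b, b < n → Z b = Polynomial.C (nodeY h b) := by
    intro b hb
    have hbh : b < h := by omega
    have hnb : ¬ (n ≤ b ∧ b < n + t) := fun hnb => by omega
    simp only [hZ, nodeY, dif_pos hbh, hσX, hnb, if_false]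
  -- transfer along `σ`
  apply linearIndependent_of_map_ringHom σ.toRingHom hσinj
  have hV0 : (fun (x : ↥(stageRows i (n + t))) (c : Fin (windowStart (h + 1))) =>
      σ.toRingHom (krow κ (windowStart (h + 1)) (nodeY h) (x : RowLabel) c)) =
      fun (x : ↥(stageRows i (n + t))) c => krow κ (windowStart (h + 1)) Z (x : RowLabel) c := by
    funext x c
    rw [map_krow]
    rfl
  rw [hV0]
  -- stage reduction I and II
  exact linearIndependent_krow_of_blockReduced κ (windowStart (h + 1)) i n t (nodeY h) Z hZt hZlt
    (linearIndependent_kblockReducedRow κ hκ h i n t (windowStart (h + 1)) hnt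
      (det_blockMatrix_nodeY_ne_zero κ h i n t hnt hJ) IH)

/-! ## 9. The block peel theorem -/

/-- **THE BLOCK PEEL THEOREM** (linear-independence form).  Let `κ` have no zero and let
`1 = a 0 < a 1 < ⋯ < a m = h + 1` be cut points such that every block `[a q, a (q+1))` has nonzero symbolic block
determinant `det J^κ(a q, a (q+1) - a q)(Λ) ∈ ℤ[Λ]`.  Then the stage-1 `κ`-rows with symbolic Moore nodes are
linearly independent over `MvPolynomial (Fin h) ℂ`. -/
theorem linearIndependent_krow_stageOne_of_blocks (κ : ℕ → ℕ) (hκ : ∀ k, κ k ≠ 0) (h m : ℕ) (a : ℕ → ℕ)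
    (ha0 : a 0 = 1) (ham : a m = h + 1) (hmono : ∀ q, q < m → a q < a (q + 1))
    (hJ : ∀ q, q < m → (blockMatrix κ (a q) (a (q + 1) - a q)
      (fun s : Fin (a (q + 1) - a q) => (MvPolynomial.X s : MvPolynomial (Fin (a (q + 1) - a q)) ℤ))).det ≠ 0) :
    LinearIndependent (MvPolynomial (Fin h) ℂ)
      (fun x : ↥(stageRows 1 h) => krow κ (windowStart (h + 1)) (nodeY h) (x : RowLabel)) := by
  -- `a` is increasing on `[0, m]`
  have hle : ∀ k q, q + k = m → a q ≤ a m := by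
    intro k
    induction k with
    | zero => intro q hq; rw [add_zero] at hq; rw [hq]
    | succ k ih => intro q hq; exact le_trans (le_of_lt (hmono q (by omega))) (ih (q + 1) (by omega))
  have hpos : ∀ q, q ≤ m → 1 ≤ a q := by
    intro q hq
    induction q with
    | zero => rw [ha0]
    | succ q ih => exact le_trans (ih (by omega)) (le_of_lt (hmono q (by omega)))
  -- descending induction over the cut points
  have main : ∀ k q, q + k = m → LinearIndependent (MvPolynomial (Fin h) ℂ)
      (fun x : ↥(stageRows (a q) (h + 1 - a q)) => krow κ (windowStart (h + 1)) (nodeY h) (x : RowLabel)) := by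
    intro k
    induction k with
    | zero =>
      intro q hq
      rw [add_zero] at hq
      rw [hq, ham, Nat.sub_self]
      exact linearIndependent_kstageRows_terminal κ h
    | succ k ih =>
      intro q hq
      have hq1 : a q < a (q + 1) := hmono q (by omega)
      have hq2 : a (q + 1) ≤ h + 1 := ham ▸ hle k (q + 1) (by omega)
      have e1 : a q + (a (q + 1) - a q) = a (q + 1) := by omega
      have e2 : h + 1 - a (q + 1) + (a (q + 1) - a q) = h + 1 - a q := by omega
      have step := kblock_step κ hκ h (a q) (a (q + 1) - a q) (h + 1 - a (q + 1)) (by omega)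
        (hpos q (by omega)) (hJ q (by omega)) (by rw [e1]; exact ih (q + 1) (by omega))
      rw [e2] at step
      exact step
  have := main m 0 (zero_add m)
  rw [ha0] at this
  simpa using this

/-- **THE BLOCK PEEL THEOREM** (kernel poisedness).  Under the hypotheses of
`linearIndependent_krow_stageOne_of_blocks`: `KernelPoisedAt κ h`. -/
theorem kernelPoisedAt_of_blocks (κ : ℕ → ℕ) (hκ : ∀ k, κ k ≠ 0) (h m : ℕ) (a : ℕ → ℕ)
    (ha0 : a 0 = 1) (ham : a m = h + 1) (hmono : ∀ q, q < m → a q < a (q + 1))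
    (hJ : ∀ q, q < m → (blockMatrix κ (a q) (a (q + 1) - a q)
      (fun s : Fin (a (q + 1) - a q) => (MvPolynomial.X s : MvPolynomial (Fin (a (q + 1) - a q)) ℤ))).det ≠ 0) :
    KernelPoisedAt κ h :=
  kernelPoisedAt_of_linearIndependent κ h (linearIndependent_krow_stageOne_of_blocks κ hκ h m a ha0 ham hmono hJ)

/-- **THE BLOCK PEEL THEOREM for the segment kernel** (`κ = k!`): a block tiling of `[1, h]` with nonzero
symbolic block determinants gives the line file's `SegmentMeanValueAt h` VERBATIM (the statement of node #1
`stub_segmentMeanValue` at height `h`). -/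
theorem segmentMeanValueAt_of_blocks (h m : ℕ) (a : ℕ → ℕ)
    (ha0 : a 0 = 1) (ham : a m = h + 1) (hmono : ∀ q, q < m → a q < a (q + 1))
    (hJ : ∀ q, q < m → (blockMatrix Nat.factorial (a q) (a (q + 1) - a q)
      (fun s : Fin (a (q + 1) - a q) => (MvPolynomial.X s : MvPolynomial (Fin (a (q + 1) - a q)) ℤ))).det ≠ 0) :
    ∀ (r : ℕ) (u : Fin r → Finset (Fin h)), Function.Injective u → (∀ i, (u i).card ≤ 2) →
      (∀ S : Finset (Fin h), S.card ≤ 2 → ∃ i, u i = S) →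
      ∃ P : Fin h → Fin h → ℂ,
        (Matrix.of fun i j : Fin r =>
          ∑ g : (↥(benchCols h r j) → ↥(u i)), (∏ c : ↥(benchCols h r j), P (g c) c) *
            ∏ a : ↥(u i),
              ((Finset.univ.filter fun c : ↥(benchCols h r j) => g c = a).card.factorial : ℂ)).det ≠ 0 :=
  kernelPoisedAt_of_blocks Nat.factorial (fun k => Nat.factorial_ne_zero k) h m a ha0 ham hmono hJ

/-! ## 10. Blocks of length one are the stages of THEOREM A^κ -/

/-- For `t = 1` the block matrix is `G^κ_i` conjugated by monomials:
`Λ^q · J^κ(i,1)[⟨0,q⟩, ⟨0,m⟩] = G^κ_i[q, m] · Λ^{c_i + m}`. -/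
theorem blockMatrix_one_apply {R : Type*} [CommRing R] (κ : ℕ → ℕ) (i : ℕ) (Λ : Fin 1 → R) (q m : Fin i) :
    Λ 0 ^ (q : ℕ) * blockMatrix κ i 1 Λ ⟨0, ⟨q, by simp⟩⟩ ⟨0, ⟨m, by simp⟩⟩ =
      ((kpeelMatrix κ i q m : ℤ) : R) * Λ 0 ^ (windowStart i + (m : ℕ)) := by
  have hpos : (finSigmaFinEquiv (⟨0, ⟨m, by simp⟩⟩ : BlockIdx i 1) : ℕ) = m := by
    rw [finSigmaFinEquiv_apply]
    simp
  have hq : ((⟨0, ⟨q, by simp⟩⟩ : BlockIdx i 1).2 : ℕ) < i := q.2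
  rw [blockMatrix, Matrix.of_apply, blockEntry, if_pos hq, hpos, kpeelMatrix_eq_kincl, Int.cast_natCast]
  show Λ 0 ^ (q : ℕ) * ((((kincl κ (q : ℕ) (windowStart i + (m : ℕ))) : ℕ) : R) *
      Λ 0 ^ (windowStart i + (m : ℕ) - (q : ℕ))) = _
  by_cases hsub : bits (q : ℕ) ⊆ bits (windowStart i + (m : ℕ))
  · have e := add_bin_sdiff_eq hsub
    have e2 : (q : ℕ) + (windowStart i + (m : ℕ) - (q : ℕ)) = windowStart i + (m : ℕ) := by omega
    rw [mul_left_comm, ← pow_add, e2]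
  · rw [kincl_of_not_subset κ hsub, Nat.cast_zero, zero_mul, mul_zero, zero_mul]

/-- **Blocks of length one**: over a domain of characteristic zero in which `Λ_0 ≠ 0`,
`det J^κ(i,1)(Λ) ≠ 0 ↔ det G^κ_i ≠ 0`.  In particular THEOREM A^κ is the all-singleton case of the block peel
theorem. -/
theorem det_blockMatrix_one_ne_zero_iff {R : Type*} [CommRing R] [IsDomain R] [CharZero R] (κ : ℕ → ℕ)
    (i : ℕ) (Λ : Fin 1 → R) (hΛ : Λ 0 ≠ 0) :
    (blockMatrix κ i 1 Λ).det ≠ 0 ↔ (kpeelMatrix κ i).det ≠ 0 := by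
  classical
  -- reindex `BlockIdx i 1 ≃ Fin i`
  have he'e : ∀ ρ : BlockIdx i 1,
      (⟨0, ⟨(ρ.2 : ℕ), by have := ρ.2.2; have := ρ.1.2; simp only [Fin.val_zero, add_zero]; omega⟩⟩ :
        BlockIdx i 1) = ρ := by
    rintro ⟨s, q⟩
    obtain rfl : s = 0 := Fin.eq_zero s
    rfl
  set E : BlockIdx i 1 ≃ Fin i :=
    ⟨fun ρ => ⟨ρ.2, by have := ρ.2.2; simp at this; omega⟩, fun q => ⟨0, ⟨q, by simp⟩⟩, he'e, fun q => rfl⟩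
    with hE
  -- `diag(Λ^q) · J = G · diag(Λ^{c_i+m})` after reindexing
  have key : Matrix.diagonal (fun q : Fin i => Λ 0 ^ (q : ℕ)) * Matrix.reindex E E (blockMatrix κ i 1 Λ) =
      (kpeelMatrix κ i).map (Int.castRingHom R) *
        Matrix.diagonal (fun m : Fin i => Λ 0 ^ (windowStart i + (m : ℕ))) := by
    ext q m
    rw [Matrix.diagonal_mul, Matrix.mul_diagonal, Matrix.reindex_apply, Matrix.submatrix_apply, Matrix.map_apply,
      eq_intCast]
    exact blockMatrix_one_apply κ i Λ q m
  have hdet := congrArg Matrix.det key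
  rw [Matrix.det_mul, Matrix.det_mul, Matrix.det_diagonal, Matrix.det_reindex_self, Matrix.det_diagonal,
    ← RingHom.mapMatrix_apply, ← RingHom.map_det, eq_intCast] at hdet
  have h1 : (∏ q : Fin i, Λ 0 ^ (q : ℕ)) ≠ 0 := Finset.prod_ne_zero_iff.mpr fun q _ => pow_ne_zero _ hΛ
  have h2 : (∏ m : Fin i, Λ 0 ^ (windowStart i + (m : ℕ))) ≠ 0 :=
    Finset.prod_ne_zero_iff.mpr fun m _ => pow_ne_zero _ hΛ
  constructor
  · intro hJ hG
    rw [hG, Int.cast_zero, zero_mul] at hdet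
    exact (mul_ne_zero h1 hJ) hdet
  · intro hG hJ
    rw [hJ, mul_zero] at hdet
    exact (mul_ne_zero (Int.cast_ne_zero.mpr hG) h2) hdet.symm

/-- The symbolic instance: `det J^κ(i,1)(Λ) ≠ 0` in `ℤ[Λ_0]` iff `det G^κ_i ≠ 0`. -/
theorem det_blockMatrix_one_X_ne_zero_iff (κ : ℕ → ℕ) (i : ℕ) :
    (blockMatrix κ i 1 (fun s : Fin 1 => (MvPolynomial.X s : MvPolynomial (Fin 1) ℤ))).det ≠ 0 ↔
      (kpeelMatrix κ i).det ≠ 0 :=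
  det_blockMatrix_one_ne_zero_iff κ i _ (MvPolynomial.X_ne_zero _)

end Summit.ValiantsHypothesis.ValiantsHypothesis.Theorems.BarrierLever.MoorePeel
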